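import Summits.SmoothPoincare4.SmoothPoincare4.Theorems.CylinderEntropyCylinderRungTwoFluxIdentityGram
import HarnessLib

/-!
# Flux identity, part 2: chart representatives and the area formula on chart pieces

Part of the proof of the stub `stub_fluxIdentity` (the FLUX IDENTITY `|∫_M ν₅ d(ι^*μH⁴)| = μH⁴(S⁴)`
for connected compact cross-sections of `N = S⁴ × ℝ ⊂ ℝ⁶`) of line `killing-flux` of the crux
`CylinderEntropy.CylinderRungTwo` (stmt-SmoothPoincare4-7631); see the final file
`CylinderEntropyCylinderRungTwoFluxIdentity.lean` for the overall argument. Everything here is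
proved (no named facts); theorems only.

* chart representatives `Φ = ι ∘ φ⁻¹` and their differentials; `sqrt_det_gram_shadow` — the Gram
  density of `D(truncL ∘ Φ)` is `|ν₅|` times that of `DΦ`;
* `setLIntegral_comap_eq_chart` — the induced area measure `ι^*𝓗⁴ = Measure.comap ι μHE[4]` in a
  chart (tree area formula for injective immersions, Federer 3.2.3/3.2.5);
* `measure_shadow_piece` — `𝓗⁴(shadow S) = ∫_S |ν₅| d(ι^*𝓗⁴)` on an injectivity piece;
* `exists_injOn_nhd_of_regular` — local injectivity of the shadow where `ν₅ ≠ 0`.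
-/

-- the prescribed namespace `Summit.SmoothPoincare4.SmoothPoincare4.…` repeats `SmoothPoincare4`
set_option linter.dupNamespace false

noncomputable section

open MeasureTheory Set Function Filter Module
open scoped Manifold ContDiff ENNReal Topology RealInnerProductSpace NNReal

namespace Summit.SmoothPoincare4.SmoothPoincare4.Theorems.CylinderRungTwo.KillingFlux

open Literature.Geometry.Riemannian
open Literature.Geometry.Lorentzian Literature.Geometry.Lorentzian.PseudoRiemannianMetric
open Literature.Geometry.Riemannian.SphericalCylinderEntropy (truncL truncL_apply lipschitz_truncL
  hausdorffMeasure_sphere_four_pos hausdorffMeasure_sphere_four_lt_top)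
open Literature.Geometry.Manifold.CylinderSlice (axis castSucc_ne_five)

section Setup

variable {M : Type} [TopologicalSpace M] [ChartedSpace (EuclideanSpace ℝ (Fin 4)) M]

variable [IsManifold (𝓡 4) ∞ M]

/-! ### Chart representatives -/

/-- The chart representative `ι ∘ φ⁻¹` is differentiable on the chart target with differential
`dι ∘ D(φ⁻¹)` (tree: `hasFDerivAt_comp_extChartAt_symm`). [folklore] -/
theorem hasFDerivAt_chartRep {ι : M → (EuclideanSpace ℝ (Fin 6))} (hι : Manifold.IsSmoothEmbedding (𝓡 4) (𝓡 6) ∞ ι)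
    (x₀ : M) {u : (EuclideanSpace ℝ (Fin 4))} (hu : u ∈ (extChartAt (𝓡 4) x₀).target) :
    HasFDerivAt ((ι ∘ (extChartAt (𝓡 4) x₀).symm)) (((ContinuousLinearMap.comp (mfderiv (𝓡 4) (𝓡 6) ι ((extChartAt
          (𝓡 4) x₀).symm u)) (mfderivWithin 𝓘(ℝ, EuclideanSpace ℝ (Fin 4)) (𝓡 4) (extChartAt (𝓡 4) x₀).symm
          (Set.range (𝓡 4)) u)) : EuclideanSpace ℝ (Fin 4) →L[ℝ] EuclideanSpace ℝ (Fin 6))) u :=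
  hasFDerivAt_comp_extChartAt_symm hι.contMDiff x₀ hu

/-- The chart representative is `C^∞` on the chart target. [folklore] -/
theorem contDiffOn_chartRep {ι : M → (EuclideanSpace ℝ (Fin 6))} (hι : Manifold.IsSmoothEmbedding (𝓡 4) (𝓡 6) ∞ ι)
    (x₀ : M) : ContDiffOn ℝ ∞ ((ι ∘ (extChartAt (𝓡 4) x₀).symm)) (extChartAt (𝓡 4) x₀).target :=
  (hι.contMDiff.comp_contMDiffOn (contMDiffOn_extChartAt_symm (n := ∞) x₀)).contDiffOn

/-- The differential of the chart representative is continuous on the chart target. [folklore] -/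
theorem continuousOn_chartDeriv {ι : M → (EuclideanSpace ℝ (Fin 6))} (hι : Manifold.IsSmoothEmbedding (𝓡 4) (𝓡 6) ∞
      ι)
    (x₀ : M) : ContinuousOn (fun u => ((ContinuousLinearMap.comp (mfderiv (𝓡 4) (𝓡 6) ι ((extChartAt (𝓡 4) x₀).symm
          u)) (mfderivWithin 𝓘(ℝ, EuclideanSpace ℝ (Fin 4)) (𝓡 4) (extChartAt (𝓡 4) x₀).symm (Set.range (𝓡 4)) u)) :
          EuclideanSpace ℝ (Fin 4) →L[ℝ] EuclideanSpace ℝ (Fin 6))) (extChartAt (𝓡 4) x₀).target := by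
  refine ((contDiffOn_chartRep hι x₀).continuousOn_fderiv_of_isOpen (isOpen_extChartAt_target x₀)
    (by simp)).congr fun u hu => ?_
  exact (hasFDerivAt_chartRep hι x₀ hu).fderiv.symm

/-- The differential of the chart representative is injective (immersion, invertible chart
differential). [folklore] -/
theorem chartDeriv_injective {ι : M → (EuclideanSpace ℝ (Fin 6))} (hι : Manifold.IsSmoothEmbedding (𝓡 4) (𝓡 6) ∞ ι)
    (x₀ : M) {u : (EuclideanSpace ℝ (Fin 4))} (hu : u ∈ (extChartAt (𝓡 4) x₀).target) :
    Injective (((ContinuousLinearMap.comp (mfderiv (𝓡 4) (𝓡 6) ι ((extChartAt (𝓡 4) x₀).symm u)) (mfderivWithin 𝓘(ℝ,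
          EuclideanSpace ℝ (Fin 4)) (𝓡 4) (extChartAt (𝓡 4) x₀).symm (Set.range (𝓡 4)) u)) : EuclideanSpace ℝ (Fin
          4) →L[ℝ] EuclideanSpace ℝ (Fin 6))) :=
  (mfderiv_injective_of_isSmoothEmbedding hι _).comp
    (isInvertible_mfderivWithin_extChartAt_symm hu).injective

omit [IsManifold (𝓡 4) ∞ M] in
/-- The chart representative of an embedding is injective on the chart target. [folklore] -/
theorem injOn_chartRep {ι : M → (EuclideanSpace ℝ (Fin 6))} (hι : Manifold.IsSmoothEmbedding (𝓡 4) (𝓡 6) ∞ ι) (x₀ :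
      M) :
    InjOn ((ι ∘ (extChartAt (𝓡 4) x₀).symm)) (extChartAt (𝓡 4) x₀).target := by
  refine hι.isEmbedding.injective.injOn.comp ?_ (mapsTo_univ _ _)
  simpa using (extChartAt (𝓡 4) x₀).symm.injOn

/-- **The Jacobian of the shadow in a chart**: the Gram density of `D(truncL ∘ ι ∘ φ⁻¹)(u)` is
`|ν₅(φ⁻¹ u)|` times that of `D(ι ∘ φ⁻¹)(u)`. [folklore] -/
theorem sqrt_det_gram_shadow {ι ν : M → (EuclideanSpace ℝ (Fin 6))} (hι : Manifold.IsSmoothEmbedding (𝓡 4) (𝓡 6) ∞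
      ι)
    (hιN : ∀ x, ∑ i : Fin 5, ι x (Fin.castSucc i) ^ 2 = 1)
    (hνn : (euclideanMetric (EuclideanSpace ℝ (Fin 6))).IsUnitNormal (𝓡 4) ι ν 1)
    (hνt : ∀ x, ∑ i : Fin 5, ν x (Fin.castSucc i) * ι x (Fin.castSucc i) = 0)
    (x₀ : M) {u : (EuclideanSpace ℝ (Fin 4))} (hu : u ∈ (extChartAt (𝓡 4) x₀).target) :
    Real.sqrt ((Matrix.of fun i j => ⟪(fun i => (truncL.comp (((ContinuousLinearMap.comp (mfderiv (𝓡 4) (𝓡 6) ι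
          ((extChartAt (𝓡 4) x₀).symm u)) (mfderivWithin 𝓘(ℝ, EuclideanSpace ℝ (Fin 4)) (𝓡 4) (extChartAt (𝓡 4)
          x₀).symm (Set.range (𝓡 4)) u)) : EuclideanSpace ℝ (Fin 4) →L[ℝ] EuclideanSpace ℝ (Fin 6))))
          (EuclideanSpace.basisFun (Fin 4) ℝ i)) i, (fun i => (truncL.comp (((ContinuousLinearMap.comp (mfderiv (𝓡
          4) (𝓡 6) ι ((extChartAt (𝓡 4) x₀).symm u)) (mfderivWithin 𝓘(ℝ, EuclideanSpace ℝ (Fin 4)) (𝓡 4) (extChartAt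
          (𝓡 4) x₀).symm (Set.range (𝓡 4)) u)) : EuclideanSpace ℝ (Fin 4) →L[ℝ] EuclideanSpace ℝ (Fin 6))))
          (EuclideanSpace.basisFun (Fin 4) ℝ i)) j⟫)).det =
      |ν ((extChartAt (𝓡 4) x₀).symm u) 5| *
        Real.sqrt ((Matrix.of fun i j => ⟪(fun i => (((ContinuousLinearMap.comp (mfderiv (𝓡 4) (𝓡 6) ι ((extChartAt
              (𝓡 4) x₀).symm u)) (mfderivWithin 𝓘(ℝ, EuclideanSpace ℝ (Fin 4)) (𝓡 4) (extChartAt (𝓡 4) x₀).symm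
              (Set.range (𝓡 4)) u)) : EuclideanSpace ℝ (Fin 4) →L[ℝ] EuclideanSpace ℝ (Fin 6)))
              (EuclideanSpace.basisFun (Fin 4) ℝ i)) i, (fun i => (((ContinuousLinearMap.comp (mfderiv (𝓡 4) (𝓡 6) ι
              ((extChartAt (𝓡 4) x₀).symm u)) (mfderivWithin 𝓘(ℝ, EuclideanSpace ℝ (Fin 4)) (𝓡 4) (extChartAt (𝓡 4)
              x₀).symm (Set.range (𝓡 4)) u)) : EuclideanSpace ℝ (Fin 4) →L[ℝ] EuclideanSpace ℝ (Fin 6)))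
              (EuclideanSpace.basisFun (Fin 4) ℝ i)) j⟫)).det := by
  set y := (extChartAt (𝓡 4) x₀).symm u with hy
  set w : Fin 4 → (EuclideanSpace ℝ (Fin 6)) := fun i => (((ContinuousLinearMap.comp (mfderiv (𝓡 4) (𝓡 6) ι
        ((extChartAt (𝓡 4) x₀).symm u)) (mfderivWithin 𝓘(ℝ, EuclideanSpace ℝ (Fin 4)) (𝓡 4) (extChartAt (𝓡 4)
        x₀).symm (Set.range (𝓡 4)) u)) : EuclideanSpace ℝ (Fin 4) →L[ℝ] EuclideanSpace ℝ (Fin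
        6))) (EuclideanSpace.basisFun (Fin 4) ℝ i) with hw
  have hdetpos := Literature.Geometry.GeometricMeasureTheory.sqrt_det_gram_pos_of_injective
    (EuclideanSpace.basisFun (Fin 4) ℝ) (((ContinuousLinearMap.comp (mfderiv (𝓡 4) (𝓡 6) ι ((extChartAt (𝓡 4)
          x₀).symm u)) (mfderivWithin 𝓘(ℝ, EuclideanSpace ℝ (Fin 4)) (𝓡 4) (extChartAt (𝓡 4) x₀).symm (Set.range (𝓡
          4)) u)) : EuclideanSpace ℝ (Fin 4) →L[ℝ] EuclideanSpace ℝ (Fin 6))) (chartDeriv_injective hι x₀ hu)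
  have hdet : ((Matrix.of fun i j => ⟪w i, w j⟫)).det ≠ 0 := by
    intro h0
    have : Real.sqrt ((Matrix.of fun i j => ⟪w i, w j⟫)).det = 0 := by rw [h0, Real.sqrt_zero]
    exact absurd this (ne_of_gt hdetpos)
  have key := det_gram_truncL w ((ι y - ι y 5 • (axis : EuclideanSpace ℝ (Fin 6)))) (ν y)
    (fun i => inner_nrad_mfderiv hι hιN y _) (fun i => inner_nu_mfderiv hνn y _)
    (inner_nu_nrad hνt y) (norm_nrad hιN y) (norm_nu hνn y) (nrad_apply_five ι y) hdet
  change Real.sqrt ((Matrix.of fun i j => ⟪(fun i => truncL (w i)) i, (fun i => truncL (w i))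
        j⟫)).det = |ν y 5| * Real.sqrt ((Matrix.of fun i j => ⟪w i, w j⟫)).det
  rw [key, Real.sqrt_mul (sq_nonneg _), Real.sqrt_sq_eq_abs]

end Setup

/-! ## §3 Area formula on chart pieces -/

section AreaPieces

open Literature.Geometry.GeometricMeasureTheory

variable {M : Type} [TopologicalSpace M] [ChartedSpace (EuclideanSpace ℝ (Fin 4)) M] [IsManifold (𝓡 4) ∞ M]

/-- The shadow `truncL ∘ ι ∘ φ⁻¹` read in a chart is differentiable with differential
`truncL ∘ DΦ`. [folklore] -/
theorem hasFDerivAt_shadow_chartRep {ι : M → (EuclideanSpace ℝ (Fin 6))} (hι : Manifold.IsSmoothEmbedding (𝓡 4) (𝓡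
      6) ∞ ι)
    (x₀ : M) {u : (EuclideanSpace ℝ (Fin 4))} (hu : u ∈ (extChartAt (𝓡 4) x₀).target) :
    HasFDerivAt (fun u => truncL (((ι ∘ (extChartAt (𝓡 4) x₀).symm)) u)) (truncL.comp (((ContinuousLinearMap.comp
          (mfderiv (𝓡 4) (𝓡 6) ι ((extChartAt (𝓡 4) x₀).symm u)) (mfderivWithin 𝓘(ℝ, EuclideanSpace ℝ (Fin 4)) (𝓡 4)
          (extChartAt (𝓡 4) x₀).symm (Set.range (𝓡 4)) u)) : EuclideanSpace ℝ (Fin 4) →L[ℝ] EuclideanSpace ℝ (Fin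
          6)))) u :=
  truncL.hasFDerivAt.comp u (hasFDerivAt_chartRep hι x₀ hu)

/-- Continuity of `u ↦ truncL ∘ DΦ(u)` on the chart target. [folklore] -/
theorem continuousOn_shadow_chartDeriv {ι : M → (EuclideanSpace ℝ (Fin 6))}
    (hι : Manifold.IsSmoothEmbedding (𝓡 4) (𝓡 6) ∞ ι) (x₀ : M) :
    ContinuousOn (fun u => truncL.comp (((ContinuousLinearMap.comp (mfderiv (𝓡 4) (𝓡 6) ι ((extChartAt (𝓡 4)
          x₀).symm u)) (mfderivWithin 𝓘(ℝ, EuclideanSpace ℝ (Fin 4)) (𝓡 4) (extChartAt (𝓡 4) x₀).symm (Set.range (𝓡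
          4)) u)) : EuclideanSpace ℝ (Fin 4) →L[ℝ] EuclideanSpace ℝ (Fin 6)))) (extChartAt (𝓡 4) x₀).target :=
  ((ContinuousLinearMap.compL ℝ (EuclideanSpace ℝ (Fin 4)) (EuclideanSpace ℝ (Fin 6)) (EuclideanSpace ℝ (Fin 5)))
        truncL).continuous.comp_continuousOn
    (continuousOn_chartDeriv hι x₀)

/-- Where `ν₅ ≠ 0`, the shadow read in a chart is an immersion (its Gram density is
`|ν₅| · √det(Gram DΦ) > 0`). [folklore] -/
theorem shadow_chartDeriv_injective {ι ν : M → (EuclideanSpace ℝ (Fin 6))}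
    (hι : Manifold.IsSmoothEmbedding (𝓡 4) (𝓡 6) ∞ ι)
    (hιN : ∀ x, ∑ i : Fin 5, ι x (Fin.castSucc i) ^ 2 = 1)
    (hνn : (euclideanMetric (EuclideanSpace ℝ (Fin 6))).IsUnitNormal (𝓡 4) ι ν 1)
    (hνt : ∀ x, ∑ i : Fin 5, ν x (Fin.castSucc i) * ι x (Fin.castSucc i) = 0)
    (x₀ : M) {u : (EuclideanSpace ℝ (Fin 4))} (hu : u ∈ (extChartAt (𝓡 4) x₀).target)
    (hν5 : ν ((extChartAt (𝓡 4) x₀).symm u) 5 ≠ 0) :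
    Injective (truncL.comp (((ContinuousLinearMap.comp (mfderiv (𝓡 4) (𝓡 6) ι ((extChartAt (𝓡 4) x₀).symm u))
          (mfderivWithin 𝓘(ℝ, EuclideanSpace ℝ (Fin 4)) (𝓡 4) (extChartAt (𝓡 4) x₀).symm (Set.range (𝓡 4)) u)) :
          EuclideanSpace ℝ (Fin 4) →L[ℝ] EuclideanSpace ℝ (Fin 6)))) := by
  by_contra hni
  have h0 := det_gram_eq_zero_of_not_injective (EuclideanSpace.basisFun (Fin 4) ℝ)
    ((truncL.comp (((ContinuousLinearMap.comp (mfderiv (𝓡 4) (𝓡 6) ι ((extChartAt (𝓡 4) x₀).symm u)) (mfderivWithin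
          𝓘(ℝ, EuclideanSpace ℝ (Fin 4)) (𝓡 4) (extChartAt (𝓡 4) x₀).symm (Set.range (𝓡 4)) u)) : EuclideanSpace ℝ
          (Fin 4) →L[ℝ] EuclideanSpace ℝ (Fin 6))) : (EuclideanSpace ℝ (Fin 4)) →L[ℝ] (EuclideanSpace ℝ (Fin 5))) :
          (EuclideanSpace ℝ (Fin 4)) →ₗ[ℝ] (EuclideanSpace ℝ (Fin 5))) hni
  have hid := sqrt_det_gram_shadow hι hιN hνn hνt x₀ hu
  have hpos := sqrt_det_gram_pos_of_injective (EuclideanSpace.basisFun (Fin 4) ℝ)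
    (((ContinuousLinearMap.comp (mfderiv (𝓡 4) (𝓡 6) ι ((extChartAt (𝓡 4) x₀).symm u)) (mfderivWithin 𝓘(ℝ,
          EuclideanSpace ℝ (Fin 4)) (𝓡 4) (extChartAt (𝓡 4) x₀).symm (Set.range (𝓡 4)) u)) : EuclideanSpace ℝ (Fin
          4) →L[ℝ] EuclideanSpace ℝ (Fin 6))) (chartDeriv_injective hι x₀ hu)
  have hlhs : Real.sqrt ((Matrix.of fun i j => ⟪(fun i => (truncL.comp (((ContinuousLinearMap.comp (mfderiv (𝓡 4) (𝓡
        6) ι ((extChartAt (𝓡 4) x₀).symm u)) (mfderivWithin 𝓘(ℝ, EuclideanSpace ℝ (Fin 4)) (𝓡 4) (extChartAt (𝓡 4)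
        x₀).symm (Set.range (𝓡 4)) u)) : EuclideanSpace ℝ (Fin 4) →L[ℝ] EuclideanSpace ℝ (Fin 6))))
      (EuclideanSpace.basisFun (Fin 4) ℝ i)) i, (fun i => (truncL.comp (((ContinuousLinearMap.comp (mfderiv (𝓡 4) (𝓡
            6) ι ((extChartAt (𝓡 4) x₀).symm u)) (mfderivWithin 𝓘(ℝ, EuclideanSpace ℝ (Fin 4)) (𝓡 4) (extChartAt (𝓡
            4) x₀).symm (Set.range (𝓡 4)) u)) : EuclideanSpace ℝ (Fin 4) →L[ℝ] EuclideanSpace ℝ (Fin 6))))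
      (EuclideanSpace.basisFun (Fin 4) ℝ i)) j⟫)).det = 0 := by
    rw [show ((Matrix.of fun i j => ⟪(fun i => (truncL.comp (((ContinuousLinearMap.comp (mfderiv (𝓡 4) (𝓡 6) ι
          ((extChartAt (𝓡 4) x₀).symm u)) (mfderivWithin 𝓘(ℝ, EuclideanSpace ℝ (Fin 4)) (𝓡 4) (extChartAt (𝓡 4)
          x₀).symm (Set.range (𝓡 4)) u)) : EuclideanSpace ℝ (Fin 4) →L[ℝ] EuclideanSpace ℝ (Fin 6))))
          (EuclideanSpace.basisFun (Fin 4) ℝ i)) i, (fun i => (truncL.comp (((ContinuousLinearMap.comp (mfderiv (𝓡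
          4) (𝓡 6) ι ((extChartAt (𝓡 4) x₀).symm u)) (mfderivWithin 𝓘(ℝ, EuclideanSpace ℝ (Fin 4)) (𝓡 4) (extChartAt
          (𝓡 4) x₀).symm (Set.range (𝓡 4)) u)) : EuclideanSpace ℝ (Fin 4) →L[ℝ] EuclideanSpace ℝ (Fin 6))))
          (EuclideanSpace.basisFun (Fin 4) ℝ i)) j⟫)) =
      (Matrix.of fun i j => ⟪((truncL.comp (((ContinuousLinearMap.comp (mfderiv (𝓡 4) (𝓡 6) ι ((extChartAt (𝓡 4)
            x₀).symm u)) (mfderivWithin 𝓘(ℝ, EuclideanSpace ℝ (Fin 4)) (𝓡 4) (extChartAt (𝓡 4) x₀).symm (Set.range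
            (𝓡 4)) u)) : EuclideanSpace ℝ (Fin 4) →L[ℝ] EuclideanSpace ℝ (Fin 6))) : (EuclideanSpace ℝ (Fin 4))
            →L[ℝ] (EuclideanSpace ℝ (Fin 5))) : (EuclideanSpace ℝ (Fin 4)) →ₗ[ℝ] (EuclideanSpace ℝ (Fin 5)))
        (EuclideanSpace.basisFun (Fin 4) ℝ i),
        ((truncL.comp (((ContinuousLinearMap.comp (mfderiv (𝓡 4) (𝓡 6) ι ((extChartAt (𝓡 4) x₀).symm u))
              (mfderivWithin 𝓘(ℝ, EuclideanSpace ℝ (Fin 4)) (𝓡 4) (extChartAt (𝓡 4) x₀).symm (Set.range (𝓡 4)) u)) :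
              EuclideanSpace ℝ (Fin 4) →L[ℝ] EuclideanSpace ℝ (Fin 6))) : (EuclideanSpace ℝ (Fin 4)) →L[ℝ]
              (EuclideanSpace ℝ (Fin 5))) : (EuclideanSpace ℝ (Fin 4)) →ₗ[ℝ] (EuclideanSpace ℝ (Fin 5)))
        (EuclideanSpace.basisFun (Fin 4) ℝ j)⟫) from rfl, h0, Real.sqrt_zero]
  rw [hlhs] at hid
  have : 0 < |ν ((extChartAt (𝓡 4) x₀).symm u) 5| *
      Real.sqrt ((Matrix.of fun i j => ⟪(fun i => (((ContinuousLinearMap.comp (mfderiv (𝓡 4) (𝓡 6) ι ((extChartAt (𝓡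
            4) x₀).symm u)) (mfderivWithin 𝓘(ℝ, EuclideanSpace ℝ (Fin 4)) (𝓡 4) (extChartAt (𝓡 4) x₀).symm
            (Set.range (𝓡 4)) u)) : EuclideanSpace ℝ (Fin 4) →L[ℝ] EuclideanSpace ℝ (Fin 6)))
            (EuclideanSpace.basisFun (Fin 4) ℝ i)) i, (fun i => (((ContinuousLinearMap.comp (mfderiv (𝓡 4) (𝓡 6) ι
            ((extChartAt (𝓡 4) x₀).symm u)) (mfderivWithin 𝓘(ℝ, EuclideanSpace ℝ (Fin 4)) (𝓡 4) (extChartAt (𝓡 4)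
            x₀).symm (Set.range (𝓡 4)) u)) : EuclideanSpace ℝ (Fin 4) →L[ℝ] EuclideanSpace ℝ (Fin 6)))
            (EuclideanSpace.basisFun (Fin 4) ℝ i)) j⟫)).det :=
    mul_pos (abs_pos.2 hν5) hpos
  linarith

variable [CompactSpace M] [MeasurableSpace M] [BorelSpace M]

omit [IsManifold (𝓡 4) ∞ M] in
/-- A smooth embedding of a compact manifold into `ℝ⁶` is a closed, hence measurable, embedding.
[folklore] -/
theorem measurableEmbedding_of_emb {ι : M → (EuclideanSpace ℝ (Fin 6))}
    (hι : Manifold.IsSmoothEmbedding (𝓡 4) (𝓡 6) ∞ ι) : MeasurableEmbedding ι :=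
  (hι.contMDiff.continuous.isClosedEmbedding hι.isEmbedding.injective).measurableEmbedding

/-- **Chart-local area formula for the induced area measure `ι^* 𝓗⁴`** (`𝓗⁴ = μHE[4]`, the
Euclidean-normalised Hausdorff measure): for measurable `S` inside the chart domain at `x₀` and
measurable `g ≥ 0`,
`∫_S g d(ι^*𝓗⁴) = ∫_{φ S} g(φ⁻¹ u) √det(⟪DΦ(u) eᵢ, DΦ(u) eⱼ⟫) du` (tree area formula for the
injective immersion `Φ = ι ∘ φ⁻¹`, Federer 3.2.3/3.2.5). [cite: Federer1969, 3.2.5] -/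
theorem setLIntegral_comap_eq_chart {ι : M → (EuclideanSpace ℝ (Fin 6))} (hι : Manifold.IsSmoothEmbedding (𝓡 4) (𝓡
      6) ∞ ι)
    (x₀ : M) {S : Set M} (hS : MeasurableSet S) (hSx : S ⊆ (extChartAt (𝓡 4) x₀).source)
    {g : M → ℝ≥0∞} (hg : Measurable g) :
    ∫⁻ x in S, g x ∂(Measure.comap ι (μHE[4] : Measure (EuclideanSpace ℝ (Fin 6)))) =
      ∫⁻ u in (extChartAt (𝓡 4) x₀) '' S, g ((extChartAt (𝓡 4) x₀).symm u) *
        ENNReal.ofReal (Real.sqrt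
          ((Matrix.of fun i j => ⟪(fun i => (((ContinuousLinearMap.comp (mfderiv (𝓡 4) (𝓡 6) ι ((extChartAt (𝓡 4)
                x₀).symm u)) (mfderivWithin 𝓘(ℝ, EuclideanSpace ℝ (Fin 4)) (𝓡 4) (extChartAt (𝓡 4) x₀).symm
                (Set.range (𝓡 4)) u)) : EuclideanSpace ℝ (Fin 4) →L[ℝ] EuclideanSpace ℝ (Fin 6)))
                (EuclideanSpace.basisFun (Fin 4) ℝ i)) i, (fun i => (((ContinuousLinearMap.comp (mfderiv (𝓡 4) (𝓡 6)
                ι ((extChartAt (𝓡 4) x₀).symm u)) (mfderivWithin 𝓘(ℝ, EuclideanSpace ℝ (Fin 4)) (𝓡 4) (extChartAt (𝓡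
                4) x₀).symm (Set.range (𝓡 4)) u)) : EuclideanSpace ℝ (Fin 4) →L[ℝ] EuclideanSpace ℝ (Fin 6)))
                (EuclideanSpace.basisFun (Fin 4) ℝ i)) j⟫)).det) := by
  set φ := extChartAt (𝓡 4) x₀ with hφ
  have hme := measurableEmbedding_of_emb hι
  obtain ⟨g', hg'm, hg'⟩ := hme.exists_measurable_extend hg fun _ => ⟨0⟩
  have hgg : ∀ x, g x = g' (ι x) := fun x => by rw [← hg']; rfl
  -- `∫_S g d(ι^* μ) = ∫_{ι S} g' dμ`
  have h1 : ∫⁻ x in S, g x ∂(Measure.comap ι (μHE[4] : Measure (EuclideanSpace ℝ (Fin 6)))) =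
      ∫⁻ z in ι '' S, g' z ∂(μHE[4] : Measure (EuclideanSpace ℝ (Fin 6))) := by
    simp_rw [hgg]
    rw [hme.restrict_comap, ← hme.lintegral_map, hme.map_comap,
      Measure.restrict_restrict hme.measurableSet_range,
      inter_eq_self_of_subset_right (image_subset_range _ _)]
  rw [h1]
  -- the area formula for `Φ = ι ∘ φ⁻¹` on `φ '' S`
  have hU : IsOpen φ.target := isOpen_extChartAt_target x₀
  have hS' : MeasurableSet (φ '' S) := measurableSet_image_extChartAt x₀ hS hSx
  have hS'U : φ '' S ⊆ φ.target := fun y ⟨z, hz, hzy⟩ => hzy ▸ φ.map_source (hSx hz)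
  have harea := lintegral_image_eq_lintegral_mul_sqrt_det_gram (EuclideanSpace.basisFun (Fin 4) ℝ)
    hU (fun u hu => hasFDerivAt_chartRep hι x₀ hu) (continuousOn_chartDeriv hι x₀)
    (injOn_chartRep hι x₀) (fun u hu => chartDeriv_injective hι x₀ hu) hS' hS'U hg'm
  rw [finrank_euclideanSpace_fin] at harea
  have himage : ((ι ∘ (extChartAt (𝓡 4) x₀).symm)) '' (φ '' S) = ι '' S := by
    rw [image_image]
    refine image_congr fun z hz => ?_
    show ι (φ.symm (φ z)) = ι z
    rw [φ.left_inv (hSx hz)]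
  rw [himage] at harea
  rw [show ((μHE[4] : Measure (EuclideanSpace ℝ (Fin 6)))) = μHE[(4 : ℕ)] from rfl, harea]
  refine setLIntegral_congr_fun hS' fun u hu => ?_
  obtain ⟨z, hz, rfl⟩ := hu
  congr 1
  rw [hgg]
  show g' (ι (φ.symm (φ z))) = g' (ι (φ.symm (φ z)))
  rfl

/-- **Area of the shadow of a regular injectivity piece.** If `S ⊆ V ⊆ (chart domain at x₀)` with
`V` open, the shadow `truncL ∘ ι` injective on `V` and `ν₅ ≠ 0` on `V`, then
`𝓗⁴(shadow(S)) = ∫_S |ν₅| d(ι^*𝓗⁴)` (area formula for the injective immersion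
`truncL ∘ ι ∘ φ⁻¹` on `φ V`, whose Jacobian is `|ν₅|` times that of `ι ∘ φ⁻¹`).
[cite: Federer1969, 3.2.3] -/
theorem measure_shadow_piece {ι ν : M → (EuclideanSpace ℝ (Fin 6))}
    (hι : Manifold.IsSmoothEmbedding (𝓡 4) (𝓡 6) ∞ ι)
    (hιN : ∀ x, ∑ i : Fin 5, ι x (Fin.castSucc i) ^ 2 = 1)
    (hνc : Continuous ν) (hνn : (euclideanMetric (EuclideanSpace ℝ (Fin 6))).IsUnitNormal (𝓡 4) ι ν 1)
    (hνt : ∀ x, ∑ i : Fin 5, ν x (Fin.castSucc i) * ι x (Fin.castSucc i) = 0)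
    (x₀ : M) {V S : Set M} (hVo : IsOpen V) (hVx : V ⊆ (extChartAt (𝓡 4) x₀).source)
    (hinj : InjOn (fun x => truncL (ι x)) V) (hreg : ∀ x ∈ V, ν x 5 ≠ 0)
    (hS : MeasurableSet S) (hSV : S ⊆ V) :
    (μHE[4] : Measure (EuclideanSpace ℝ (Fin 5))) ((fun x => truncL (ι x)) '' S) =
      ∫⁻ x in S, ENNReal.ofReal |ν x 5| ∂(Measure.comap ι (μHE[4] : Measure (EuclideanSpace ℝ (Fin 6)))) := by
  set φ := extChartAt (𝓡 4) x₀ with hφ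
  have hSx : S ⊆ φ.source := hSV.trans hVx
  -- the open set `U = φ V` of the chart target
  set U : Set (EuclideanSpace ℝ (Fin 4)) := φ.target ∩ φ.symm ⁻¹' V with hUdef
  have hUo : IsOpen U :=
    (continuousOn_extChartAt_symm x₀).isOpen_inter_preimage (isOpen_extChartAt_target x₀) hVo
  have hUt : U ⊆ φ.target := inter_subset_left
  have hφV : φ '' V = U := φ.image_eq_target_inter_inv_preimage hVx
  -- the shadow in the chart is an injective immersion on `U`
  have hinjU : InjOn (fun u => truncL (((ι ∘ (extChartAt (𝓡 4) x₀).symm)) u)) U := by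
    rintro u ⟨hu, huV⟩ u' ⟨hu', hu'V⟩ h
    have := hinj huV hu'V h
    rw [← φ.right_inv hu, ← φ.right_inv hu', this]
  have himmU : ∀ u ∈ U, Injective (truncL.comp (((ContinuousLinearMap.comp (mfderiv (𝓡 4) (𝓡 6) ι ((extChartAt (𝓡 4)
        x₀).symm u)) (mfderivWithin 𝓘(ℝ, EuclideanSpace ℝ (Fin 4)) (𝓡 4) (extChartAt (𝓡 4) x₀).symm (Set.range (𝓡
        4)) u)) : EuclideanSpace ℝ (Fin 4) →L[ℝ] EuclideanSpace ℝ (Fin 6)))) := fun u hu =>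
    shadow_chartDeriv_injective hι hιN hνn hνt x₀ hu.1 (hreg _ hu.2)
  have hS' : MeasurableSet (φ '' S) := measurableSet_image_extChartAt x₀ hS hSx
  have hS'U : φ '' S ⊆ U := hφV ▸ image_mono hSV
  have harea := euclideanHausdorffMeasure_image_eq_lintegral_sqrt_det_gram
    (EuclideanSpace.basisFun (Fin 4) ℝ) hUo (fun u hu => hasFDerivAt_shadow_chartRep hι x₀ (hUt hu))
    ((continuousOn_shadow_chartDeriv hι x₀).mono hUt) hinjU himmU hS' hS'U
  rw [finrank_euclideanSpace_fin] at harea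
  have himage : (fun u => truncL (((ι ∘ (extChartAt (𝓡 4) x₀).symm)) u)) '' (φ '' S) = (fun x => truncL (ι
        x)) '' S := by
    rw [image_image]
    refine image_congr fun z hz => ?_
    show truncL (ι (φ.symm (φ z))) = truncL (ι z)
    rw [φ.left_inv (hSx hz)]
  rw [himage] at harea
  rw [show ((μHE[4] : Measure (EuclideanSpace ℝ (Fin 5)))) = μHE[(4 : ℕ)] from rfl, harea]
  have hmeas : Measurable fun x => ENNReal.ofReal |ν x 5| :=
    ENNReal.measurable_ofReal.comp ((continuous_abs.comp
      ((EuclideanSpace.proj (5 : Fin 6)).continuous.comp hνc)).measurable)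
  refine Eq.trans ?_ (setLIntegral_comap_eq_chart hι x₀ hS hSx hmeas).symm
  refine setLIntegral_congr_fun hS' fun u hu => ?_
  have hut : u ∈ φ.target := hUt (hS'U hu)
  rw [sqrt_det_gram_shadow hι hιN hνn hνt x₀ hut, ENNReal.ofReal_mul (abs_nonneg _)]

omit [CompactSpace M] [MeasurableSpace M] [BorelSpace M] in
/-- **Local injectivity of the shadow at a regular point.** If `ν₅(x) ≠ 0` then `x` has an open
neighbourhood `V` inside the chart domain at `x` on which the shadow `truncL ∘ ι` is injective
and `ν₅ ≠ 0` (the chart representative of the shadow has injective differential at `φ x`, hence is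
injective on a ball: tree `exists_ball_norm_sub_le_and_le`, Federer 3.2.2). [cite: Federer1969, 3.2.2] -/
theorem exists_injOn_nhd_of_regular {ι ν : M → (EuclideanSpace ℝ (Fin 6))}
    (hι : Manifold.IsSmoothEmbedding (𝓡 4) (𝓡 6) ∞ ι)
    (hιN : ∀ x, ∑ i : Fin 5, ι x (Fin.castSucc i) ^ 2 = 1)
    (hνc : Continuous ν) (hνn : (euclideanMetric (EuclideanSpace ℝ (Fin 6))).IsUnitNormal (𝓡 4) ι ν 1)
    (hνt : ∀ x, ∑ i : Fin 5, ν x (Fin.castSucc i) * ι x (Fin.castSucc i) = 0)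
    {x : M} (hx : ν x 5 ≠ 0) :
    ∃ V : Set M, IsOpen V ∧ x ∈ V ∧ V ⊆ (extChartAt (𝓡 4) x).source ∧
      InjOn (fun y => truncL (ι y)) V ∧ ∀ y ∈ V, ν y 5 ≠ 0 := by
  set φ := extChartAt (𝓡 4) x with hφ
  have hu₀ : φ x ∈ φ.target := φ.map_source (mem_extChartAt_source x)
  have hx' : ν (φ.symm (φ x)) 5 ≠ 0 := by rwa [φ.left_inv (mem_extChartAt_source x)]
  have hA := shadow_chartDeriv_injective hι hιN hνn hνt x hu₀ hx'
  obtain ⟨δ, hδ, hball, hest⟩ := exists_ball_norm_sub_le_and_le (isOpen_extChartAt_target x)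
    (fun u hu => hasFDerivAt_shadow_chartRep hι x hu) (continuousOn_shadow_chartDeriv hι x)
    hu₀ hA (C := 2) one_lt_two
  have hinjB : InjOn (fun u => truncL (((ι ∘ (extChartAt (𝓡 4) x).symm)) u)) (Metric.ball (φ x) δ) :=
    injOn_of_norm_le_mul hA fun y hy y' hy' => (hest y hy y' hy').2
  refine ⟨(φ.source ∩ φ ⁻¹' Metric.ball (φ x) δ) ∩ {y | ν y 5 ≠ 0}, ?_, ?_, ?_, ?_, ?_⟩
  · refine (isOpen_extChartAt_preimage' x Metric.isOpen_ball).inter ?_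
    exact isOpen_ne_fun ((EuclideanSpace.proj (5 : Fin 6)).continuous.comp hνc) continuous_const
  · exact ⟨⟨mem_extChartAt_source x, Metric.mem_ball_self hδ⟩, hx⟩
  · exact fun y hy => hy.1.1
  · rintro y ⟨⟨hy, hyb⟩, -⟩ y' ⟨⟨hy', hy'b⟩, -⟩ h
    have key : φ y = φ y' := by
      refine hinjB hyb hy'b ?_
      show truncL (ι (φ.symm (φ y))) = truncL (ι (φ.symm (φ y')))
      rw [φ.left_inv hy, φ.left_inv hy']
      exact h
    rw [← φ.left_inv hy, ← φ.left_inv hy', key]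
  · exact fun y hy => hy.2

end AreaPieces

/-- Marker of part 2 (registered sub-goal `stub_fluxIdentity_part2`): a smooth embedding of a
compact `4`-manifold into `ℝ⁶` is a measurable embedding (`measurableEmbedding_of_emb`). [folklore] -/
theorem stub_fluxIdentity_part2 :
    ∀ (M : Type) [TopologicalSpace M] [ChartedSpace (EuclideanSpace ℝ (Fin 4)) M] [CompactSpace M]
      [MeasurableSpace M] [BorelSpace M] (ι : M → EuclideanSpace ℝ (Fin 6)),
      Manifold.IsSmoothEmbedding (𝓡 4) (𝓡 6) ∞ ι → MeasurableEmbedding ι :=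
  fun _ _ _ _ _ _ _ hι => measurableEmbedding_of_emb hι

end Summit.SmoothPoincare4.SmoothPoincare4.Theorems.CylinderRungTwo.KillingFlux
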